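import Mathlib.GroupTheory.QuotientGroup.Defs
import Mathlib.LinearAlgebra.Span.Defs
import Literature.NumberTheory.GaloisCohomology.KatoCohomologyDifferentialForms
import HarnessLib

/-!
# Kato's `H^{n+1}_p(K)` through forms is `coker(γ − 1)` for any inverse-Cartier-type map `γ`

For a field `K` of characteristic `p > 0`, Kato's group `H^{n+1}_p(K)` is PRINTED as the cokernel
`Ωⁿ_K / (Bⁿ_K + (γ − 1)Ωⁿ_K) = coker(γ − 1 : Ωⁿ_K → Ωⁿ_K/Bⁿ_K)`, where `Bⁿ_K = dΩⁿ⁻¹_K` are the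
exact forms and `γ` is the inverse Cartier operator ([cite: GilleSzamuely2017, Thm. 9.2.4 and §9.4];
origin [cite: Kato1982, §1]).  The tree's `KatoCohomologyDeRham p K n`
(file `GaloisCohomology/KatoCohomologyDifferentialForms`) avoids `γ`: it is the quotient of
`Ωⁿ_K = ⋀ⁿ_K Ω[K⁄ℤ]` by `exactForms K n ⊔ artinSchreierForms K p n`, the latter generated by the
forms `(a^p − a) • dlog b₀ ∧ ⋯ ∧ dlog b_{n-1}`.

This file is the ABSTRACT BRIDGE between the two: for ANY additive map
`γ : Ωⁿ_K → Ωⁿ_K ⧸ Bⁿ_K` with `γ (a • dlogForm K b) = [a^p • dlogForm K b]` (the characteristic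
property of the inverse Cartier operator on logarithmic forms, `γ(dlog b) = dlog b` and
`p`-linearity, Gille–Szamuely Lemma 9.2.1 and §9.4), and provided the logarithmic forms
`dlogForm K b` span `Ωⁿ_K` over `K` (Bloch–Kato, Lemma (4.2), surjectivity — taken as the
hypothesis `hspan`), a form `ω` lies in `exactForms K n ⊔ artinSchreierForms K p n` if and only if
its class in `Ωⁿ_K ⧸ Bⁿ_K` lies in the image of `γ − 1`
(`mem_exactForms_sup_artinSchreierForms_iff_of_inverseCartier`).  Hence
`KatoCohomologyDeRham p K n = coker(γ − 1)` as soon as such a `γ` is available; the operator `γ`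
itself is supplied separately (`InverseCartierOperator`, in progress) and is NOT constructed here.

Proof: `(γ − 1)(a • dlog b) = (a^p − a) • dlog b` by the hypothesis on `γ`; one direction is an
induction over the generators of `artinSchreierForms`, the other a `K`-span induction over the
`dlogForm K b` for the `K`-stable predicate "`(γ − 1)(c • η)` is the class of an Artin–Schreier form
for every scalar `c`".

Everything is proved; no named fact is introduced.

## References

* P. Gille, T. Szamuely, *Central simple algebras and Galois cohomology*, 2nd ed., CUP 2017,
  Lemma 9.2.1, Lemma 9.2.3, Thm. 9.2.4, §9.4. [GilleSzamuely2017]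
* K. Kato, *Galois cohomology of complete discrete valuation fields*, LNM 967 (1982) 215–238, §1.
  [Kato1982]
-/

noncomputable section

namespace Literature.NumberTheory.GaloisCohomology

universe u

/-- `(γ − 1)Ωⁿ_K ⊇ artinSchreierForms (mod Bⁿ_K)`: every Artin–Schreier form `z` has class
`γ η − [η]` for some `η`, for any additive `γ` with `γ (a • dlog b) = [a^p • dlog b]`
(on a generator, `(γ − 1)(a • dlog b) = (a^p − a) • dlog b`).
[cite: GilleSzamuely2017, Lemma 9.2.3 and §9.4] -/
theorem katoCoker_exists_of_mem_artinSchreierForms (p : ℕ) (K : Type u) [Field K] (n : ℕ)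
    (γ : (⋀[K]^n (Ω[K⁄ℤ])) →+ (⋀[K]^n (Ω[K⁄ℤ])) ⧸ exactForms K n)
    (hγ : ∀ (a : K) (b : Fin n → Kˣ),
      γ (a • dlogForm K b) =
        (((a ^ p • dlogForm K b : ⋀[K]^n (Ω[K⁄ℤ])) : (⋀[K]^n (Ω[K⁄ℤ])) ⧸ exactForms K n)))
    {z : ⋀[K]^n (Ω[K⁄ℤ])} (hz : z ∈ artinSchreierForms K p n) :
    ∃ η : ⋀[K]^n (Ω[K⁄ℤ]), ((z : (⋀[K]^n (Ω[K⁄ℤ])) ⧸ exactForms K n)) =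
      γ η - ((η : ⋀[K]^n (Ω[K⁄ℤ])) : (⋀[K]^n (Ω[K⁄ℤ])) ⧸ exactForms K n) := by
  unfold artinSchreierForms at hz
  induction hz using AddSubgroup.closure_induction with
  | mem x hx =>
    obtain ⟨a, b, rfl⟩ := hx
    exact ⟨a • dlogForm K b, by rw [hγ, sub_smul (M := ⋀[K]^n (Ω[K⁄ℤ])), QuotientAddGroup.mk_sub]⟩
  | zero => exact ⟨0, by rw [map_zero, QuotientAddGroup.mk_zero, sub_zero]⟩
  | add x y _ _ hx hy =>
    obtain ⟨η₁, h₁⟩ := hx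
    obtain ⟨η₂, h₂⟩ := hy
    refine ⟨η₁ + η₂, ?_⟩
    rw [QuotientAddGroup.mk_add, h₁, h₂, map_add, QuotientAddGroup.mk_add, add_sub_add_comm]
  | neg x _ hx =>
    obtain ⟨η, h⟩ := hx
    refine ⟨-η, ?_⟩
    rw [QuotientAddGroup.mk_neg, h, map_neg, QuotientAddGroup.mk_neg, neg_sub_neg, neg_sub]

/-- `(γ − 1)Ωⁿ_K ⊆ artinSchreierForms (mod Bⁿ_K)`: if the logarithmic forms `dlogForm K b` span
`Ωⁿ_K` over `K`, then for every `η` the class `γ η − [η]` is the class of an Artin–Schreier form,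
for any additive `γ` with `γ (a • dlog b) = [a^p • dlog b]`.
[cite: GilleSzamuely2017, Lemma 9.2.3 and §9.4] -/
theorem katoCoker_exists_mem_artinSchreierForms_of_span (p : ℕ) (K : Type u) [Field K] (n : ℕ)
    (hspan : Submodule.span K (Set.range (@dlogForm K _ n)) = ⊤)
    (γ : (⋀[K]^n (Ω[K⁄ℤ])) →+ (⋀[K]^n (Ω[K⁄ℤ])) ⧸ exactForms K n)
    (hγ : ∀ (a : K) (b : Fin n → Kˣ),
      γ (a • dlogForm K b) =
        (((a ^ p • dlogForm K b : ⋀[K]^n (Ω[K⁄ℤ])) : (⋀[K]^n (Ω[K⁄ℤ])) ⧸ exactForms K n)))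
    (η : ⋀[K]^n (Ω[K⁄ℤ])) :
    ∃ z ∈ artinSchreierForms K p n,
      γ η - ((η : ⋀[K]^n (Ω[K⁄ℤ])) : (⋀[K]^n (Ω[K⁄ℤ])) ⧸ exactForms K n) =
        ((z : ⋀[K]^n (Ω[K⁄ℤ])) : (⋀[K]^n (Ω[K⁄ℤ])) ⧸ exactForms K n) := by
  suffices h : ∀ c : K, ∃ z ∈ artinSchreierForms K p n,
      γ (c • η) - ((c • η : ⋀[K]^n (Ω[K⁄ℤ])) : (⋀[K]^n (Ω[K⁄ℤ])) ⧸ exactForms K n) =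
        ((z : ⋀[K]^n (Ω[K⁄ℤ])) : (⋀[K]^n (Ω[K⁄ℤ])) ⧸ exactForms K n) by
    have h1 := h 1
    rwa [one_smul] at h1
  have hη : η ∈ Submodule.span K (Set.range (@dlogForm K _ n)) := by
    rw [hspan]
    exact Submodule.mem_top
  induction hη using Submodule.span_induction with
  | mem x hx =>
    obtain ⟨b, rfl⟩ := hx
    intro c
    exact ⟨(c ^ p - c) • dlogForm K b, smul_dlogForm_mem_artinSchreierForms K p c b, by
      rw [hγ, sub_smul (M := ⋀[K]^n (Ω[K⁄ℤ])), QuotientAddGroup.mk_sub]⟩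
  | zero =>
    intro c
    exact ⟨0, zero_mem _, by rw [smul_zero, map_zero, QuotientAddGroup.mk_zero, sub_zero]⟩
  | add x y _ _ hx hy =>
    intro c
    obtain ⟨z₁, hz₁, h₁⟩ := hx c
    obtain ⟨z₂, hz₂, h₂⟩ := hy c
    refine ⟨z₁ + z₂, add_mem hz₁ hz₂, ?_⟩
    rw [smul_add, map_add, QuotientAddGroup.mk_add, add_sub_add_comm, h₁, h₂,
      QuotientAddGroup.mk_add]
  | smul c' x _ hx =>
    intro c
    obtain ⟨z, hz, h⟩ := hx (c * c')
    exact ⟨z, hz, by rw [smul_smul]; exact h⟩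

/-- **Kato's `H^{n+1}_p(K)` through forms is `coker(γ − 1)`.**  Let `K` be a field, `p, n ∈ ℕ`,
and `γ : Ωⁿ_K → Ωⁿ_K ⧸ Bⁿ_K` any additive map with `γ (a • dlog b₀ ∧ ⋯ ∧ dlog b_{n-1}) =
[a^p • dlog b₀ ∧ ⋯ ∧ dlog b_{n-1}]` (the inverse Cartier operator has this property,
Gille–Szamuely Lemma 9.2.1 and §9.4), and assume the logarithmic forms span `Ωⁿ_K` over `K`
(Bloch–Kato, Lemma (4.2)).  Then a form `ω ∈ Ωⁿ_K` lies in
`Bⁿ_K + ⟨(a^p − a) • dlog b₀ ∧ ⋯ ∧ dlog b_{n-1}⟩ = exactForms K n ⊔ artinSchreierForms K p n` if and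
only if its class modulo `Bⁿ_K` lies in the image of `γ − 1`; i.e. the tree's
`KatoCohomologyDeRham p K n` is the printed `coker(γ − 1 : Ωⁿ_K → Ωⁿ_K/Bⁿ_K)`.
[cite: GilleSzamuely2017, Thm. 9.2.4 and §9.4]; [cite: Kato1982, §1] -/
theorem mem_exactForms_sup_artinSchreierForms_iff_of_inverseCartier (p : ℕ) (K : Type u) [Field K]
    (n : ℕ)
    (hspan : Submodule.span K (Set.range (@dlogForm K _ n)) = ⊤)
    (γ : (⋀[K]^n (Ω[K⁄ℤ])) →+ (⋀[K]^n (Ω[K⁄ℤ])) ⧸ exactForms K n)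
    (hγ : ∀ (a : K) (b : Fin n → Kˣ),
      γ (a • dlogForm K b) =
        (((a ^ p • dlogForm K b : ⋀[K]^n (Ω[K⁄ℤ])) : (⋀[K]^n (Ω[K⁄ℤ])) ⧸ exactForms K n)))
    (ω : ⋀[K]^n (Ω[K⁄ℤ])) :
    ω ∈ exactForms K n ⊔ artinSchreierForms K p n ↔
      ∃ η : ⋀[K]^n (Ω[K⁄ℤ]), ((ω : (⋀[K]^n (Ω[K⁄ℤ])) ⧸ exactForms K n)) =
        γ η - ((η : ⋀[K]^n (Ω[K⁄ℤ])) : (⋀[K]^n (Ω[K⁄ℤ])) ⧸ exactForms K n) := by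
  constructor
  · intro hω
    obtain ⟨y, hy, z, hz, rfl⟩ := AddSubgroup.mem_sup.1 hω
    obtain ⟨η, hη⟩ := katoCoker_exists_of_mem_artinSchreierForms p K n γ hγ hz
    refine ⟨η, ?_⟩
    rw [QuotientAddGroup.mk_add, (QuotientAddGroup.eq_zero_iff y).2 hy, zero_add, hη]
  · rintro ⟨η, hη⟩
    obtain ⟨z, hz, h⟩ := katoCoker_exists_mem_artinSchreierForms_of_span p K n hspan γ hγ η
    have hωz : ω - z ∈ exactForms K n := by
      rw [← QuotientAddGroup.eq_zero_iff, QuotientAddGroup.mk_sub, hη, h, sub_self]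
    rw [← sub_add_cancel ω z]
    exact AddSubgroup.add_mem_sup hωz hz

end Literature.NumberTheory.GaloisCohomology

end
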